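import Literature.AlgebraicGeometry.Hu2025.Proofs.S07GammaSchemes.Lem73BaseMaximality
import Literature.RingTheory.MvPolynomial.GenericTwoByNMinors
import Literature.AlgebraicGeometry.Kloosterman2025.GeneralFibreHilbertFunctions
import HarnessLib

/-!
# Hu 2025 (arXiv:2507.21400v1) §7.1 on the toy chart `n = 5`: `Γ = {x₁₄₅}` — `Z_Γ` is the quadric cone
# `{x₁₂₄x₁₃₅ = x₁₃₄x₁₂₅} × 𝔸⁵`, integral (typed `ZGammaIntegral` holds)

**Honest framing (D-0012/D-0089).** Kernel fact about the TYPED carrier on ONE toy instance; nothing of [Hu2025] (arXiv:2507.21400v1,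
`paper:arxiv-2507.21400`, UNREFEREED, under adjudication at rung M-Hu-min, campaign `res-hironaka`) is asserted. Provenance:
res-type-016 (typer of record of row 109). `I_{℘,{x₁₄₅}} = ⟨x₁₄₅, F̄₁, F̄₂, F̄₃⟩` is the pre-image, under the substitution
`x₁₄₅ ↦ 0, x₂₄₅ ↦ x₁₂₄x₂₃₅ − x₂₃₄x₁₂₅, x₃₄₅ ↦ x₁₃₄x₂₃₅ − x₂₃₄x₁₃₅`, of the principal ideal of the `2 × 2` minor
`x₁₂₄x₁₃₅ − x₁₃₄x₁₂₅` — prime by the tree (`isPrime_twoMinorIdeal` for the generic `2 × 2` matrix, extended along the renaming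
`Fin (2+2) ↪ Fin 9` by `Kloosterman2025.isPrime_map_rename_of_injective`); hence `Z_Γ` is integral (`zGammaIntegral_quadric`).

## References
* [Hu2025] Y. Hu, arXiv:2507.21400v1 (2025), Def. 7.1 C57L9–L24 (p.128), Lem. 7.3 C57L80 (p.129) — loci of the typed definitions only.
-/

noncomputable section

namespace Literature.AlgebraicGeometry.Hu2025.Statements.S07GammaSchemes

namespace QuadricConeToy

open MvPolynomial Lem73BaseToy Literature.RingTheory.MvPolynomial
  Literature.RingTheory.MvPolynomial.GenericTwoByNMinors Literature.AlgebraicGeometry.Kloosterman2025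

/-- `Γ = {x₁₄₅}` (index `4`). [cite: Hu2025, Def. 7.1 C57L9–L24; p.128 (unrefereed manuscript under adjudication — kernel support on a toy instance, nothing of the manuscript asserted)] -/
def Γq : Finset (Fin 9) := {4}

/-- `I_{℘,Γ}` for `Γ = {x₁₄₅}`. [cite: Hu2025, Def. 7.1 C57L14–L21; p.128 (unrefereed manuscript under adjudication — kernel support on a toy instance, nothing asserted)] -/
abbrev Iq : Ideal R := gammaWpIdeal 𝔉 (Γq : Set (Fin 9))

/-- The renaming `Fin (2+2) ↪ Fin 9` placing the generic `2 × 2` matrix at `[[x₁₂₄, x₁₃₄], [x₁₂₅, x₁₃₅]]`.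
[cite: Hu2025, Def. 3.4 C18L21; p.39 (unrefereed manuscript under adjudication — kernel support on a toy instance, nothing asserted)] -/
def e (i : Fin (2 + 2)) : Fin 9 := if i.val = 0 then 0 else if i.val = 1 then 2 else if i.val = 2 then 1 else 3

/-- `e` is injective. [cite: Hu2025, Def. 3.4 C18L21; p.39 (unrefereed manuscript under adjudication — kernel support on a toy instance, nothing asserted)] -/
theorem e_injective : Function.Injective e := by decide

/-- The quadric `q = x₁₂₄x₁₃₅ − x₁₃₄x₁₂₅` (= `x₁₄₅ − F̄₁`). [cite: Hu2025, Def. 3.4 C18L21; p.39 (unrefereed manuscript under adjudication — kernel support on a toy instance, nothing asserted)] -/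
def q : R := X 0 * X 3 - X 2 * X 1

/-- The images `x₂₄₅ ↦ g₇`, `x₃₄₅ ↦ g₈`. [cite: Hu2025, Def. 3.4 C18L23–L25; p.39–40 (unrefereed manuscript under adjudication — kernel support on a toy instance, nothing asserted)] -/
def g7 : R := X 0 * X 6 - X 5 * X 1

/-- See `g7`. [cite: Hu2025, Def. 3.4 C18L25; p.40 (unrefereed manuscript under adjudication — kernel support on a toy instance, nothing asserted)] -/
def g8 : R := X 2 * X 6 - X 5 * X 3

/-- The substitution `x₁₄₅ ↦ 0, x₂₄₅ ↦ g₇, x₃₄₅ ↦ g₈`, identity on the other six variables. [cite: Hu2025, Def. 7.1 C57L33–L43; p.128 (unrefereed manuscript under adjudication — kernel support on a toy instance, nothing asserted)] -/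
def s1 (i : Fin 9) : R := if i = 4 then 0 else if i = 7 then g7 else if i = 8 then g8 else X i

/-- The substitution as an algebra endomorphism of `R`. [cite: Hu2025, Def. 7.1 C57L33–L43; p.128 (unrefereed manuscript under adjudication — kernel support on a toy instance, nothing asserted)] -/
def e1 : R →ₐ[ℚ] R := aeval s1

/-- The extended minor ideal `P = ⟨q⟩·R` (image of `twoMinorIdeal ℚ 2` under the renaming `e`). [cite: Hu2025, Def. 7.1 C57L14–L24; p.128 (unrefereed manuscript under adjudication — kernel support on a toy instance, nothing asserted)] -/
abbrev P : Ideal R := (twoMinorIdeal ℚ 2).map (rename e : MvPolynomial (Fin (2 + 2)) ℚ →ₐ[ℚ] R)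

/-- The unique minor of the generic `2 × 2` matrix renames to `q`. [cite: Hu2025, Def. 3.4 C18L21; p.39 (unrefereed manuscript under adjudication — kernel support on a toy instance, nothing asserted)] -/
theorem rename_minor (s : Pluecker.Pair 2) : rename e (Pluecker.minor ℚ 2 s) = q := by
  have h0 : e 0 = 0 := by decide
  have h1 : e 1 = 2 := by decide
  have h2 : e 2 = 1 := by decide
  have h3 : e 3 = 3 := by decide
  obtain ⟨⟨i, j⟩, hij⟩ := s
  fin_cases i <;> fin_cases j <;> simp (config := { decide := true }) at hij
  simp [Pluecker.minor, q, h0, h1, h2, h3]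

/-- `P` is prime (tree: the minor ideal is prime; renaming along an injection preserves primality).
[cite: BrunsHerzog1998, Thm. 7.3.6 (r = 1) — via the tree; used here only for the toy] -/
theorem isPrime_P : P.IsPrime := by
  haveI : (twoMinorIdeal ℚ 2).IsPrime := isPrime_twoMinorIdeal
  exact isPrime_map_rename_of_injective e e_injective _

/-- `q ∈ P`. [cite: Hu2025, Def. 7.1 C57L14–L24; p.128 (unrefereed manuscript under adjudication — kernel support on a toy instance, nothing asserted)] -/
theorem q_mem_P : q ∈ P := by
  rw [← rename_minor (Pluecker.pr 0 1 (by decide))]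
  exact Ideal.mem_map_of_mem _ (Ideal.subset_span ⟨_, rfl⟩)

/-- `F̄ⱼ ∈ I_{℘,Γ}`. [cite: Hu2025, Def. 7.1 C57L14–L24; p.128 (unrefereed manuscript under adjudication — kernel support on a toy instance, nothing asserted)] -/
theorem rels_mem_Iq (j : Fin 3) : rels j ∈ Iq := Ideal.mem_sup_right (Ideal.subset_span ⟨j, rfl⟩)

/-- `x₁₄₅ ∈ I_{℘,Γ}`. [cite: Hu2025, Def. 7.1 C57L14–L24; p.128 (unrefereed manuscript under adjudication — kernel support on a toy instance, nothing asserted)] -/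
theorem X4_mem_Iq : (X 4 : R) ∈ Iq := Ideal.mem_sup_left (Ideal.subset_span ⟨4, by simp [Γq], rfl⟩)

/-- `q ∈ I_{℘,Γ}` (`q = x₁₄₅ − F̄₁`). [cite: Hu2025, Def. 7.1 C57L14–L24; p.128 (unrefereed manuscript under adjudication — kernel support on a toy instance, nothing asserted)] -/
theorem q_mem_Iq : q ∈ Iq := by
  have h4 : (X 4 : R) ∈ Iq := X4_mem_Iq
  have hF1 : F1 ∈ Iq := by simpa [rels] using rels_mem_Iq 0
  have : q = X 4 - F1 := by simp only [q, F1]; ring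
  rw [this]
  exact Iq.sub_mem h4 hF1

/-- `P ≤ I_{℘,Γ}`. [cite: Hu2025, Def. 7.1 C57L14–L24; p.128 (unrefereed manuscript under adjudication — kernel support on a toy instance, nothing asserted)] -/
theorem P_le_Iq : P ≤ Iq := by
  show Ideal.map _ (Ideal.span (Set.range (Pluecker.minor ℚ 2))) ≤ Iq
  rw [Ideal.map_span, Ideal.span_le]
  rintro _ ⟨_, ⟨s, rfl⟩, rfl⟩
  rw [SetLike.mem_coe]
  change rename e (Pluecker.minor ℚ 2 s) ∈ Iq
  rw [rename_minor]
  exact q_mem_Iq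

/-- Every variable is congruent to its substitute modulo `I_{℘,Γ}`. [cite: Hu2025, Def. 7.1 C57L33–L43; p.128 (unrefereed manuscript under adjudication — kernel support on a toy instance, nothing asserted)] -/
theorem X_sub_e1_mem (i : Fin 9) : (X i : R) - e1 (X i) ∈ Iq := by
  have h4 : (X 4 : R) ∈ Iq := X4_mem_Iq
  have hF2 : F2 ∈ Iq := by simpa [rels] using rels_mem_Iq 1
  have hF3 : F3 ∈ Iq := by simpa [rels] using rels_mem_Iq 2
  have e7 : (X 7 : R) - g7 = F2 := by simp only [g7, F2]; ring
  have e8 : (X 8 : R) - g8 = F3 := by simp only [g8, F3]; ring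
  fin_cases i <;> simp [e1, s1, h4, e7, e8, hF2, hF3]

/-- Hence every polynomial is congruent to its substitute modulo `I_{℘,Γ}`. [cite: Hu2025, Def. 7.1 C57L33–L43; p.128 (unrefereed manuscript under adjudication — kernel support on a toy instance, nothing asserted)] -/
theorem sub_e1_mem (f : R) : f - e1 f ∈ Iq := by
  have key : (Ideal.Quotient.mkₐ ℚ Iq).comp e1 = Ideal.Quotient.mkₐ ℚ Iq := by
    apply MvPolynomial.algHom_ext
    intro i
    simp only [AlgHom.comp_apply, Ideal.Quotient.mkₐ_eq_mk]
    rw [Ideal.Quotient.eq]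
    simpa using Iq.neg_mem (X_sub_e1_mem i)
  have := congrArg (fun h : R →ₐ[ℚ] R ⧸ Iq => h f) key
  simp only [AlgHom.comp_apply, Ideal.Quotient.mkₐ_eq_mk] at this
  rw [Ideal.Quotient.eq] at this
  simpa using Iq.neg_mem this

/-- `e1 F̄₁ = −q`. [cite: Hu2025, Def. 7.1 C57L14–L24; p.128 (unrefereed manuscript under adjudication — kernel support on a toy instance, nothing asserted)] -/
theorem e1_F1 : e1 F1 = -q := by simp [F1, e1, s1, q]; ring

/-- `e1 F̄₂ = 0`. [cite: Hu2025, Def. 7.1 C57L14–L24; p.128 (unrefereed manuscript under adjudication — kernel support on a toy instance, nothing asserted)] -/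
theorem e1_F2 : e1 F2 = 0 := by simp [F2, e1, s1, g7]

/-- `e1 F̄₃ = 0`. [cite: Hu2025, Def. 7.1 C57L14–L24; p.128 (unrefereed manuscript under adjudication — kernel support on a toy instance, nothing asserted)] -/
theorem e1_F3 : e1 F3 = 0 := by simp [F3, e1, s1, g8]

/-- `e1 F̄ⱼ ∈ P`. [cite: Hu2025, Def. 7.1 C57L14–L24; p.128 (unrefereed manuscript under adjudication — kernel support on a toy instance, nothing asserted)] -/
theorem e1_rels_mem (j : Fin 3) : e1 (rels j) ∈ P := by
  fin_cases j
  · simpa [rels, e1_F1] using P.neg_mem q_mem_P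
  · simp [rels, e1_F2]
  · simp [rels, e1_F3]

/-- The substitution kills `I_{℘,Γ}` modulo `P`. [cite: Hu2025, Def. 7.1 C57L14–L24; p.128 (unrefereed manuscript under adjudication — kernel support on a toy instance, nothing asserted)] -/
theorem Iq_le_comap : Iq ≤ P.comap (e1 : R →+* R) := by
  apply sup_le
  · rw [gammaIdeal, Ideal.span_le]
    rintro _ ⟨y, hy, rfl⟩
    have hy' : y = 4 := by simpa [Γq] using hy
    subst hy'
    simp [e1, s1]
  · rw [Ideal.span_le]
    rintro _ ⟨j, rfl⟩
    rw [SetLike.mem_coe, Ideal.mem_comap]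
    simpa using e1_rels_mem j

/-- **`I_{℘,{x₁₄₅}}` is the pre-image of the (prime) extended minor ideal under the substitution.**
[cite: Hu2025, Def. 7.1 C57L14–L24; p.128 (unrefereed manuscript under adjudication — kernel support on a toy instance, nothing of the manuscript asserted)] -/
theorem Iq_eq_comap : Iq = P.comap (e1 : R →+* R) := by
  refine le_antisymm Iq_le_comap fun f hf => ?_
  rw [Ideal.mem_comap] at hf
  have h1 := sub_e1_mem f
  have h2 : e1 f ∈ Iq := P_le_Iq hf
  simpa using Iq.add_mem h1 h2

/-- **`Z_Γ` is integral for `Γ = {x₁₄₅}` (`n = 5`; a quadric cone)** — the typed J1 hypothesis `ZGammaIntegral` holds here.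
[cite: Hu2025, Lem. 7.3 C57L80 «Assume that Z_Γ is integral»; p.129 (unrefereed manuscript under adjudication — kernel fact about the typed carrier on a toy instance, nothing of the manuscript asserted)] -/
theorem zGammaIntegral_quadric : ZGammaIntegral 𝔉 (Γq : Set (Fin 9)) := by
  unfold ZGammaIntegral GammaSchemeRing
  haveI : P.IsPrime := isPrime_P
  haveI : Iq.IsPrime := by rw [Iq_eq_comap]; exact Ideal.IsPrime.comap _
  exact (Ideal.Quotient.isDomain_iff_prime Iq).mpr inferInstance

end QuadricConeToy

end Literature.AlgebraicGeometry.Hu2025.Statements.S07GammaSchemes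

end
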